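import Summits.Langlands.Langlands.Theorems.PhantomRMYoshidaResiduallyYoshidaLiftingNonsplitNotSymplectic
import Summits.Langlands.Langlands.Theorems.PhantomRMYoshidaResiduallyYoshidaLiftingNonsplitInvariantSubspaces
import Mathlib.LinearAlgebra.Matrix.NonsingularInverse
import Mathlib.LinearAlgebra.Matrix.ToLin
import HarnessLib

/-!
# The radical of the residual Gram form is the `σ̄`-plane (stub `stub_residualGramRadical`, G3) —
# line `sector-klingen-split`, crux `ResiduallyYoshidaLifting` (stmt-Langlands-13639)

Stub-worker file of lead prover-line-stmt-Langlands-13639-c5-0 (2026-08-17), skeleton rev 13, sub-goal G3, namespace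
`…SectorKlingenSplit.Fibre`.

**Statement (`stub_residualGramRadical`).**  `k` a field of characteristic `p ≠ 2`, `red : ℤ̄_p → k` a ring map,
`σ, σ' : Γ → GL₂(k)` irreducible with `σ'` NOT a pointwise-scalar twist of a conjugate of `σ`, `B : Γ → M₂(k)` NOT a
coboundary, `rint : Γ → GL₄(ℤ̄_p)` an integral frame reducing through `red` to `M_g = h (σ g, B g; 0, σ' g) h⁻¹`
(blocks along `finSumFinEquiv`), and `G₀ ∈ M₄(ℤ̄_p)` alternating with `red G₀ ≠ 0`, preserved by `rint` up to units
`νi g` (`(rint g)ᵀ G₀ (rint g) = νi g • G₀`).  Then the radical of the residual Gram form `Ḡ = red G₀` is EXACTLY the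
`σ`-plane: `Ḡ x = 0 ↔ x = h (a, 0)` for some `a ∈ k²`.

**Proof.**
* Reduce the similitude identity through `red`: `M_gᵀ Ḡ M_g = red (νi g) • Ḡ`, so the radical `R = ker Ḡ` is
  `M_g`-stable (`M_gᵀ (Ḡ (M_g x)) = red (νi g) • Ḡ x = 0`, cancel the invertible `M_gᵀ`).
* Transport along `φ w = h (w ∘ e⁻¹)` (`e = finSumFinEquiv`, inverse `ψ y = (h⁻¹ y) ∘ e`): `W = φ⁻¹ R ⊆ k² ⊕ k²` is
  stable under the block matrices `(σ g, B g; 0, σ' g)` because `M_g (φ w) = φ ((σ g, B g; 0, σ' g) w)`.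
* `W ≠ ⊤` since `Ḡ ≠ 0`; `W ≠ ⊥`: otherwise `Ḡ` has trivial kernel, `det Ḡ ≠ 0`, and `M_g` would be a similitude group
  of a NON-DEGENERATE alternating form — excluded by G1 (`stub_nonsplitNotSymplectic`, p166285; `2 ≠ 0` in `k` from
  `char k = p ≠ 2`).
* The invariant-subspace trichotomy (`Ribet.stub_nonsplitInvariantSubspaces`, p152467) leaves `W = k² ⊕ 0`, i.e.
  `Ḡ x = 0 ↔ ψ x ∈ k² ⊕ 0 ↔ x = h (a, 0)`.

Pure Mathlib matrix algebra on top of the two landed files; no named facts.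
-/

noncomputable section

-- `Summit.Langlands.Langlands.…` (summit = sub-problem name, D-0017 layout) trips `dupNamespace` on every decl.
set_option linter.dupNamespace false
set_option autoImplicit false

open scoped Matrix

namespace Summit.Langlands.Langlands.Cruxes.ResiduallyYoshidaLifting.SectorKlingenSplit.Fibre

open Literature.NumberTheory.GaloisRepresentations

/-! ### Linear-algebra helpers -/

/-- An invertible square matrix kills no non-zero vector: `A v = 0 → v = 0` when `det A` is a unit
(`v = A⁻¹ (A v)`). [folklore] -/
theorem eq_zero_of_mulVec_eq_zero_of_isUnit_det {K : Type*} [CommRing K] {n : Type*} [Fintype n] [DecidableEq n]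
    (A : Matrix n n K) (hA : IsUnit A.det) (v : n → K) (h : A *ᵥ v = 0) : v = 0 :=
  calc v = A⁻¹ *ᵥ (A *ᵥ v) := by rw [Matrix.mulVec_mulVec, Matrix.nonsing_inv_mul A hA, Matrix.one_mulVec]
    _ = 0 := by rw [h, Matrix.mulVec_zero]

/-- The radical of a square matrix `G` is stable under an invertible similitude `Mᵀ G M = c • G`:
`G x = 0 → G (M x) = 0`, since `Mᵀ (G (M x)) = c • G x = 0` and `Mᵀ` is invertible. [folklore] -/
theorem mulVec_mulVec_eq_zero_of_similitude {K : Type*} [CommRing K] {n : Type*} [Fintype n] [DecidableEq n]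
    (M G : Matrix n n K) (c : K) (hM : IsUnit M.det) (h : Mᵀ * G * M = c • G) (x : n → K) (hx : G *ᵥ x = 0) :
    G *ᵥ (M *ᵥ x) = 0 := by
  refine eq_zero_of_mulVec_eq_zero_of_isUnit_det Mᵀ (Matrix.isUnit_det_transpose M hM) _ ?_
  rw [Matrix.mulVec_mulVec, Matrix.mulVec_mulVec, h, Matrix.smul_mulVec, hx, smul_zero]

/-- A square matrix over a field with trivial kernel (`G v = 0 → v = 0`) has non-zero determinant. [folklore] -/
theorem det_ne_zero_of_mulVec_eq_zero_imp {K : Type*} [Field K] {n : Type*} [Fintype n] [DecidableEq n]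
    (G : Matrix n n K) (hG : ∀ v, G *ᵥ v = 0 → v = 0) : G.det ≠ 0 := by
  have hinj : Function.Injective G.mulVec := fun v₁ v₂ h12 => by
    rw [← sub_eq_zero]
    exact hG _ (by rw [Matrix.mulVec_sub, h12, sub_self])
  exact ((Matrix.isUnit_iff_isUnit_det _).mp (Matrix.mulVec_injective_iff_isUnit.mp hinj)).ne_zero

/-- A matrix over a commutative ring whose action on vectors vanishes identically is zero. [folklore] -/
theorem eq_zero_of_forall_mulVec_eq_zero {K : Type*} [CommRing K] {m n : Type*} [Fintype n] [DecidableEq n]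
    (G : Matrix m n K) (hG : ∀ v, G *ᵥ v = 0) : G = 0 := by
  refine (LinearEquiv.map_eq_zero_iff Matrix.toLin').mp (LinearMap.ext fun v => ?_)
  rw [Matrix.toLin'_apply, LinearMap.zero_apply]
  exact hG v

/-! ### The registered stub -/

/-- **Registered sub-goal G3 `stub_residualGramRadical`** (crux stmt-Langlands-13639, line `sector-klingen-split`,
skeleton rev 13, assembly of G1 + the trichotomy p152467): for an integral frame `rint` realising the NON-trivial class
`B` of a NON-twist pair with irreducible constituents (`char k = p ≠ 2`), preserving the alternating integral `G₀` with
unit multiplier and `red G₀ ≠ 0` (G2), the RADICAL of the residual Gram form `red G₀` is EXACTLY the `σ̄`-plane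
`h (k² ⊕ 0)`: it is a stable subspace (`Ḡ₀ M̄ x = ν̄ M̄⁻ᵀ Ḡ₀ x`), proper (`Ḡ₀ ≠ 0`), non-zero (G1), hence the `σ̄`-plane
(trichotomy). [folklore] -/
theorem stub_residualGramRadical :
    ∀ (p : ℕ) [Fact p.Prime], p ≠ 2 → ∀ (k : Type) [Field k] [CharP k p] (Γ : Type) [Group Γ]
      (red : Valued.integer (PadicAlgCl p) →+* k) (σ σ' : Γ →* GL (Fin 2) k),
      Representation.IsIrreducible ((glStdRepresentation (Fin 2) k).comp σ) →
      Representation.IsIrreducible ((glStdRepresentation (Fin 2) k).comp σ') →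
      (¬ ∃ g : GL (Fin 2) k, ∀ x, ∃ c : k, (g * σ x * g⁻¹).val = c • (σ' x).val) →
      ∀ (B : Γ → Matrix (Fin 2) (Fin 2) k),
      (¬ ∃ X : Matrix (Fin 2) (Fin 2) k, ∀ g, B g = (σ g).val * X - X * (σ' g).val) →
      ∀ (rint : Γ →* GL (Fin 4) (Valued.integer (PadicAlgCl p))) (h : GL (Fin 4) k),
      (∀ g, (Matrix.GeneralLinearGroup.map red (rint g)).val =
          h.val * Matrix.reindex finSumFinEquiv finSumFinEquiv
            (Matrix.fromBlocks (σ g).val (B g) 0 (σ' g).val) * (h⁻¹).val) →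
      ∀ (G₀ : Matrix (Fin 4) (Fin 4) (Valued.integer (PadicAlgCl p))) (νi : Γ → Valued.integer (PadicAlgCl p)),
      G₀ᵀ = -G₀ → G₀.map red ≠ 0 → (∀ g, IsUnit (νi g)) →
      (∀ g, (rint g).valᵀ * G₀ * (rint g).val = νi g • G₀) →
      ∀ x : Fin 4 → k, G₀.map red *ᵥ x = 0 ↔
        ∃ a : Fin 2 → k, x = h.val *ᵥ fun i => Sum.elim a 0 ((finSumFinEquiv (m := 2) (n := 2)).symm i) := by
  intro p _ hp k _ _ Γ _ red σ σ' hσ hσ' hnt B hB rint h hred G₀ νi hG₀t hG₀ _hνi hsim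
  set e : Fin 2 ⊕ Fin 2 ≃ Fin 4 := finSumFinEquiv with he
  -- `char k = p ≠ 2`
  have h2 : (2 : k) ≠ 0 := fun h0 => hp <|
    (Nat.prime_dvd_prime_iff_eq (Fact.out : p.Prime) Nat.prime_two).mp
      ((CharP.cast_eq_zero_iff k p 2).mp (by exact_mod_cast h0))
  -- the residual matrices `M g = red (rint g) = h (σ g, B g; 0, σ' g) h⁻¹`
  obtain ⟨M, hM⟩ : ∃ M : Γ → Matrix (Fin 4) (Fin 4) k, M = fun g =>
      h.val * Matrix.reindex e e (Matrix.fromBlocks (σ g).val (B g) 0 (σ' g).val) * (h⁻¹).val := ⟨_, rfl⟩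
  have hMg : ∀ g, M g = h.val * Matrix.reindex e e (Matrix.fromBlocks (σ g).val (B g) 0 (σ' g).val) * (h⁻¹).val :=
    fun g => by rw [hM]
  have hredval : ∀ g, (rint g).val.map red = M g := fun g => by rw [hMg]; exact hred g
  have hMunit : ∀ g, IsUnit (M g).det := fun g => by
    rw [← hredval g]
    exact (Matrix.isUnit_iff_isUnit_det _).mp (Matrix.GeneralLinearGroup.map red (rint g)).isUnit
  -- the residual Gram form is alternating, with the reduced similitude identity
  have hGbt : (G₀.map red)ᵀ = -G₀.map red := by
    rw [← Matrix.transpose_map, hG₀t, Matrix.map_neg _ (map_neg red)]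
  have hsimb : ∀ g, (M g)ᵀ * G₀.map red * M g = red (νi g) • G₀.map red := fun g => by
    have e0 := congrArg (fun A : Matrix (Fin 4) (Fin 4) (Valued.integer (PadicAlgCl p)) => A.map red) (hsim g)
    rw [Matrix.map_mul, Matrix.map_mul, Matrix.transpose_map, hredval g, Matrix.map_smul' _ _ _ (map_mul red)] at e0
    exact e0
  -- (1) transport: `φ w = h (w ∘ e⁻¹)` with inverse `y ↦ (h⁻¹ y) ∘ e`
  obtain ⟨φ, hφ⟩ : ∃ φ : (Fin 2 ⊕ Fin 2 → k) →ₗ[k] (Fin 4 → k), ∀ w, φ w = h.val *ᵥ (w ∘ ⇑e.symm) :=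
    ⟨(Matrix.mulVecLin h.val).comp (LinearMap.funLeft k k ⇑e.symm), fun w => rfl⟩
  have hcomp : ∀ w : Fin 2 ⊕ Fin 2 → k, (w ∘ ⇑e.symm) ∘ ⇑e = w := fun w =>
    funext fun s => by rw [Function.comp_apply, Function.comp_apply, Equiv.symm_apply_apply]
  have hcomp' : ∀ y : Fin 4 → k, (y ∘ ⇑e) ∘ ⇑e.symm = y := fun y =>
    funext fun i => by rw [Function.comp_apply, Function.comp_apply, Equiv.apply_symm_apply]
  have hφψ : ∀ y : Fin 4 → k, φ (((h⁻¹).val *ᵥ y) ∘ ⇑e) = y := fun y => by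
    rw [hφ, hcomp', Matrix.mulVec_mulVec, Units.mul_inv, Matrix.one_mulVec]
  -- (2) the pulled-back radical `W = φ⁻¹ (ker red G₀)` is a stable subspace of `k² ⊕ k²`
  obtain ⟨W, hWmem⟩ : ∃ W : Submodule k (Fin 2 ⊕ Fin 2 → k), ∀ w, w ∈ W ↔ G₀.map red *ᵥ φ w = 0 :=
    ⟨LinearMap.ker ((Matrix.mulVecLin (G₀.map red)).comp φ), fun w => by
      rw [LinearMap.mem_ker, LinearMap.comp_apply, Matrix.mulVecLin_apply]⟩
  have hWstab : ∀ g, ∀ w ∈ W, (Matrix.fromBlocks (σ g).val (B g) 0 (σ' g).val).mulVec w ∈ W := fun g w hw => by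
    rw [hWmem] at hw ⊢
    have e1 : φ (Matrix.fromBlocks (σ g).val (B g) 0 (σ' g).val *ᵥ w) = M g *ᵥ φ w := by
      rw [hφ, hφ, hMg, Matrix.mulVec_mulVec, Matrix.mul_assoc, Units.inv_mul, Matrix.mul_one,
        ← Matrix.mulVec_mulVec, Matrix.reindex_apply, Matrix.submatrix_mulVec_equiv, Equiv.symm_symm, hcomp]
    rw [e1]
    exact mulVec_mulVec_eq_zero_of_similitude (M g) _ _ (hMunit g) (hsimb g) _ hw
  -- `W ≠ ⊤`: `red G₀ ≠ 0`
  have hWtop : W ≠ ⊤ := fun htop => hG₀ <| eq_zero_of_forall_mulVec_eq_zero _ fun y => by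
    rw [← hφψ y, ← hWmem, htop]
    exact Submodule.mem_top
  -- `W ≠ ⊥`: else `red G₀` is non-degenerate and `M` is a similitude group of it, excluded by G1
  have hWbot : W ≠ ⊥ := fun hbot => by
    have hker : ∀ y, G₀.map red *ᵥ y = 0 → y = 0 := fun y hy => by
      have hw : ((h⁻¹).val *ᵥ y) ∘ ⇑e ∈ W := by rw [hWmem, hφψ]; exact hy
      rw [hbot, Submodule.mem_bot] at hw
      rw [← hφψ y, hw, map_zero]
    refine stub_nonsplitNotSymplectic k h2 Γ σ σ' hnt B hB h (G₀.map red) (fun g => red (νi g)) hGbt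
      (det_ne_zero_of_mulVec_eq_zero_imp _ hker) fun g => ?_
    have e0 := hsimb g
    rw [hMg] at e0
    exact e0
  -- (3) the trichotomy: `W` is the `σ`-plane
  rcases Ribet.stub_nonsplitInvariantSubspaces k Γ σ σ' hσ hσ' B hB W hWstab with hbot | htop | hpl
  · exact (hWbot hbot).elim
  · exact (hWtop htop).elim
  -- (4) back to `Fin 4` coordinates
  intro x
  constructor
  · intro hx
    have hw : ((h⁻¹).val *ᵥ x) ∘ ⇑e ∈ W := by rw [hWmem, hφψ]; exact hx
    refine ⟨((h⁻¹).val *ᵥ x) ∘ ⇑e ∘ Sum.inl, ?_⟩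
    have e2 : (fun i : Fin 4 => Sum.elim (((h⁻¹).val *ᵥ x) ∘ ⇑e ∘ Sum.inl) 0 (e.symm i)) = (h⁻¹).val *ᵥ x := by
      funext i
      obtain ⟨s, rfl⟩ := e.surjective i
      rw [Equiv.symm_apply_apply]
      rcases s with i' | j
      · rfl
      · exact ((hpl _).mp hw j).symm
    rw [e2, Matrix.mulVec_mulVec, Units.mul_inv, Matrix.one_mulVec]
  · rintro ⟨a, rfl⟩
    have hw : Sum.elim a 0 ∈ W := (hpl _).mpr fun _ => rfl
    rw [hWmem, hφ] at hw
    exact hw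

end Summit.Langlands.Langlands.Cruxes.ResiduallyYoshidaLifting.SectorKlingenSplit.Fibre

end
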